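import Literature.AnabelianGeometry.AbsoluteAnabelian.AbsTopIProp410TemperedModelRankThree
import Literature.AnabelianGeometry.SemiGraphs.TemperedFreeThreeSlim
import Literature.AnabelianGeometry.SemiGraphs.TemperedProfiniteProducts
import Literature.AnabelianGeometry.SemiGraphs.OncePuncturedTemperedGroupPadicWitness
import HarnessLib

/-!
# [AbsTopI] Prop 4.10 (iii): conj. 1 of `CoFreeCofinalImAlong` is NOT a consequence of the other
# residues — a NON-COMPACT tempered model at which node (iii) FAILS (schema-negative, proof-only)

S. Mochizuki, *Topics in Absolute Anabelian Geometry I: Generalities* [AbsTopI] (2012), §0 p. 8,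
Def 4.2 (iii)(c) p. 50, Prop 4.10 (iii) p. 60 ("the natural homomorphism `Π^tp_X → Π^tp_Y` [...] may
be reconstructed [...] as the natural morphism from `Π^tp_X` to the co-free completion of `Π^tp_X`
with respect to `Π̂^tp_Y`"); manuscript pagination, lit key `paper:url-11ac98ba15fc`, read on the
page.  [SemiAnbd] Def 3.1 (i) p. 33, Ex 3.10 pp. 43–45; [EtTh] §1 p. 12 (fibre-product tempered
models `F̂ₙ ×_Ẑ ℤ`: abc-iut-w5-d218's `TemperedFibreProduct*.lean`, `TemperedFreeThreeSlim.lean`).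

Context: node AbsTopI:Prop4.10(iii) of `HOME/plan/L4/SUBDAG-AbsTopI-Prop410.md` is proved AT THE
CONSTRUCTION over the residues {(CF_Δ), conj. 1 `hleft`, tfg `Δ^tp_X`, `dX`, `dY`, `hmin`}
(`prop410iiiAt_of_geometric_residues`); all but `hleft` are INTRINSIC to one of the two curves.
THIS FILE proves that `hleft` can be neither dropped nor derived from the others.  Datum:
* `X`: `K = ℚ_p`, `Π^tp_X := Γ₃ × G_{ℚ_p}`, `Γ₃ = F̂₃ ×_Ẑ ℤ` the fibre product for the completed
  exponent sum of the third generator `c` of `F₃ = ⟨a, b, c⟩` (TEMPERED, SLIM, second countable,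
  NON-compact: `Γ₃ ↠ ℤ`; profinite completion `pr₁ : Γ₃ → F̂₃`); one cusp, inertia `îa(Ẑ) × 0 ≅ Ẑ`;
* `Y`: `Π^tp_Y := F̂₂ × G_{ℚ_p}` (compact), no points; `f̂ = π̂ × id`, `π̂` killing `a`, `f = f̂ ∘ toHat`
  (kernel clause `ker_prodMap_id_eq`).
The four intrinsic residues HOLD — (CF_Δ), `hmin` on the compact `Δ^tp_Y` (compact case), tfg of
`Δ^tp_X ≅ Γ₃` (density of the graph of `F₃`), `dX` (slimness of `Γ₃`, `centralizer_eq_bot_of_isOpen₃`;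
of `G_{ℚ_p}`, [pGC] Lem 15.8; `IsTempered.prod_of_profinite`), `dY` — while **`hleft` FAILS and BOTH
CLAUSES OF NODE (iii) FAIL**: `(Δ^tp_X)^{co-fr} = Γ₃,₀ × 1` is the COMPACT slice
(`cofreeCore_top_prod_bot`: "one-loop dual graph"), so `K_X(Δ^tp_X) ≤ Ker(ê) × 1` (`ê` the second
exponent character of `F̂₂`) has infinite index and contains no `K_Y(H′) ⊇ H′`; and under (iii)
`Π^tp_X ⧸ K_X(Δ^tp_X) ↠ ℤ` would be compact (`compactSpace_quotient_piKer_of_prop410iiiAt`).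
Main statement: `exists_temperedModel_not_prop410iiiAt`.

HONEST READING: the counter-datum is NOT a pair of curves — `Π^tp_Y` is profinite, which the L3/L4
interfaces (`TemperedCurve`, `DeCuspidalization`, `GroupLevelData`) allow: it certifies in the kernel
the gen-6 verdict that conj. 1 is an irreducible input about the TEMPERED topology of `Y` RELATIVE to
`X` (what an L3↔L4 bridge must supply); it is no claim about [AbsTopI].  Proof-only (no `def`/
instance/named fact; FACT-LIST untouched).  No side taken on [IUTchIII] Cor 3.12; typed ≠ proved.
-/

noncomputable section

namespace Literature.AnabelianGeometry.AbsoluteAnabelian.AbsTopI.Prop410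

open _root_.Topology _root_.Filter _root_.Set _root_.Function
open Literature.AnabelianGeometry.SemiGraphs
open Literature.AnabelianGeometry.AbsoluteAnabelian.AbsTopI
open Literature.IUT.HodgeTheaters (profiniteCompletion toCompletion toCompletion_int_injective)
open Literature.AlgebraicGeometry.Frobenioids (IsSlimGroup)
open TemperedFibreProduct

/-- **Conj. 1 `hleft` of `CoFreeCofinalImAlong` is independent of the other residues, and node (iii)
fails without it** — at the non-compact tempered model `Γ₃ × G_{ℚ_p} ↠ F̂₂ × G_{ℚ_p}` of the module
docstring: (CF_Δ), `hmin`, tfg `Δ^tp_X`, `dX`, `dY` hold, `Π^tp_X` is not compact, `hleft` fails, and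
both `Prop410iiiAt E` and `Prop410iiiDeltaAt E` fail. [cite: MochizukiAbsTopI2012, Prop 4.10 (iii) p.60] -/
theorem exists_temperedModel_not_prop410iiiAt (p : ℕ) [Fact p.Prime] :
    ∃ (X Y : TemperedCurve p) (E : DeCuspidalization X Y),
      (∀ N : OpenNormalSubgroup Y.DeltaTemp, ∃ H' : CharOpenSubgroup Y.DeltaTemp,
          (cofreeCore H'.toSubgroup).subgroupOf Y.DeltaTemp ≤ N.toSubgroup) ∧
      (∀ H' : CharOpenSubgroup Y.DeltaTemp, ∃ M, IsMinimalCofreeIn H'.toSubgroup M) ∧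
      IsTopologicallyFinitelyGenerated X.DeltaTemp ∧
      Nonempty X.GroupLevelData ∧ Nonempty Y.GroupLevelData ∧ ¬ CompactSpace X.PiTemp ∧
      ¬ (∀ H : CharOpenSubgroup X.DeltaTemp, ∃ H' : CharOpenSubgroup Y.DeltaTemp,
          coFreeKernel ((ContinuousMonoidHom.id Y.PiHat).comp Y.toHat) H'.toSubgroup ≤
            coFreeKernel (E.fHat.comp X.toHat) H.toSubgroup) ∧
      ¬ Prop410iiiAt E ∧ ¬ Prop410iiiDeltaAt E := by
  classical
  haveI : IsGalois ℚ_[p] (AlgebraicClosure ℚ_[p]) := {}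
  haveI : T2Space (GQp p) := krullTopology_t2
  let P3 : ProfiniteGrp.{0} := profiniteCompletion (FreeGroup (Fin 3))
  let P2 : ProfiniteGrp.{0} := profiniteCompletion (FreeGroup (Fin 2))
  let Zh : ProfiniteGrp.{0} := profiniteCompletion (Multiplicative ℤ)
  let η₃ : FreeGroup (Fin 3) →* P3 := toCompletion _; let η₂ : FreeGroup (Fin 2) →* P2 := toCompletion _
  let ι : Multiplicative ℤ →* Zh := toCompletion (Multiplicative ℤ)
  let a : FreeGroup (Fin 3) := FreeGroup.of 0; let b : FreeGroup (Fin 3) := FreeGroup.of 1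
  let c : FreeGroup (Fin 3) := FreeGroup.of 2
  let ex : Fin 3 → FreeGroup (Fin 3) →* Multiplicative ℤ := fun i =>
    FreeGroup.lift fun j => if j = i then Multiplicative.ofAdd (1 : ℤ) else 1
  let σa := ex 0; let σb := ex 1; let σc := ex 2
  have hσaa : σa a = Multiplicative.ofAdd 1 := by simp [σa, ex, a]
  have hσab : σa b = 1 := by simp [σa, ex, b]
  have hσba : σb a = 1 := by simp [σb, ex, a]
  have hσbb : σb b = Multiplicative.ofAdd 1 := by simp [σb, ex, b]
  have hσca : σc a = 1 := by simp [σc, ex, a]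
  have hσcb : σc b = 1 := by simp [σc, ex, b]
  have hσcc : σc c = Multiplicative.ofAdd 1 := by simp [σc, ex, c]
  let σ₂ : FreeGroup (Fin 2) →* Multiplicative ℤ :=
    FreeGroup.lift fun j => if j = (1 : Fin 2) then Multiplicative.ofAdd (1 : ℤ) else 1
  have hσ₂1 : σ₂ (FreeGroup.of 1) = Multiplicative.ofAdd 1 := by simp [σ₂]
  let π : FreeGroup (Fin 3) →* FreeGroup (Fin 2) :=
    FreeGroup.lift ![(1 : FreeGroup (Fin 2)), FreeGroup.of 0, FreeGroup.of 1]
  let s : FreeGroup (Fin 2) →* FreeGroup (Fin 3) := FreeGroup.lift ![FreeGroup.of (1 : Fin 3), FreeGroup.of 2]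
  have hπa : π a = 1 := by simp [π, a]
  have hπs : ∀ w : FreeGroup (Fin 2), π (s w) = w := proj₃_section
  have hσ₂π : ∀ u, σ₂ (π u) = σc u := expSum₂_comp_proj₃
  have hkerπ : π.ker ≤ Subgroup.normalClosure ({FreeGroup.of 0} : Set (FreeGroup (Fin 3))) :=
    ker_proj₃_le_normalClosure
  let e : P3 →ₜ* Zh := (ProfiniteGrp.ProfiniteCompletion.lift (GrpCat.ofHom (ι.comp σc))).hom
  let êa : P3 →ₜ* Zh := (ProfiniteGrp.ProfiniteCompletion.lift (GrpCat.ofHom (ι.comp σa))).hom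
  let êb : P3 →ₜ* Zh := (ProfiniteGrp.ProfiniteCompletion.lift (GrpCat.ofHom (ι.comp σb))).hom
  let ê₂ : P2 →ₜ* Zh := (ProfiniteGrp.ProfiniteCompletion.lift (GrpCat.ofHom (ι.comp σ₂))).hom
  let πh : P3 →ₜ* P2 := (ProfiniteGrp.ProfiniteCompletion.lift (GrpCat.ofHom (η₂.comp π))).hom
  let sh : P2 →ₜ* P3 := (ProfiniteGrp.ProfiniteCompletion.lift (GrpCat.ofHom (η₃.comp s))).hom
  let îa : Zh →ₜ* P3 :=
    (ProfiniteGrp.ProfiniteCompletion.lift (GrpCat.ofHom (η₃.comp (zpowersHom _ a)))).hom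
  let îb : Zh →ₜ* P3 :=
    (ProfiniteGrp.ProfiniteCompletion.lift (GrpCat.ofHom (η₃.comp (zpowersHom _ b)))).hom
  have he : ∀ g, e (η₃ g) = ι (σc g) := fun g => lift_hom_toCompletion Zh (ι.comp σc) g
  have hêa : ∀ g, êa (η₃ g) = ι (σa g) := fun g => lift_hom_toCompletion Zh (ι.comp σa) g
  have hêb : ∀ g, êb (η₃ g) = ι (σb g) := fun g => lift_hom_toCompletion Zh (ι.comp σb) g
  have hê₂ : ∀ w, ê₂ (η₂ w) = ι (σ₂ w) := fun w => lift_hom_toCompletion Zh (ι.comp σ₂) w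
  have hπh : ∀ g, πh (η₃ g) = η₂ (π g) := fun g => lift_hom_toCompletion P2 (η₂.comp π) g
  have hsh : ∀ w, sh (η₂ w) = η₃ (s w) := fun w => lift_hom_toCompletion P3 (η₃.comp s) w
  have hîa : ∀ k : ℤ, îa (ι (Multiplicative.ofAdd k)) = η₃ (a ^ k) := fun k => by
    rw [lift_hom_toCompletion P3 (η₃.comp (zpowersHom _ a))]; simp [zpowersHom_apply]
  have hîb : ∀ k : ℤ, îb (ι (Multiplicative.ofAdd k)) = η₃ (b ^ k) := fun k => by
    rw [lift_hom_toCompletion P3 (η₃.comp (zpowersHom _ b))]; simp [zpowersHom_apply]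
  have hιinj : Injective ι := toCompletion_int_injective
  have heîa : ∀ t, e (îa t) = 1 := TemperedFibreProduct.apply_apply_eq_one_of a σc hσca e îa he hîa
  have hêaîa : ∀ t, êa (îa t) = t := TemperedFibreProduct.apply_apply_eq_self_of a σa hσaa êa îa hêa hîa
  have hd3 : DenseRange η₃ := ProfiniteGrp.ProfiniteCompletion.denseRange (GrpCat.of (FreeGroup (Fin 3)))
  have hê₂πh : ∀ x, ê₂ (πh x) = e x := by
    have h := hd3.equalizer (ê₂.continuous.comp πh.continuous) e.continuous (by
      funext u; change ê₂ (πh (η₃ u)) = e (η₃ u); rw [hπh, hê₂, hσ₂π, he])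
    exact fun x => congr_fun h x
  -- the fibre product `Γ₃ = F̂₃ ×_Ẑ ℤ` for `e = ê_c`
  let Γ : Subgroup (P3 × Multiplicative ℤ) :=
    (e.toMonoidHom.comp (MonoidHom.fst P3 (Multiplicative ℤ))).eqLocus
      (ι.comp (MonoidHom.snd P3 (Multiplicative ℤ)))
  have hΓ : ∀ q : P3 × Multiplicative ℤ, q ∈ Γ ↔ e q.1 = ι q.2 := fun q => Iff.rfl
  have hηN : ∀ N : Subgroup (FreeGroup (Fin 3)), N.Normal → N.FiniteIndex →
      ∃ V : OpenNormalSubgroup P3, ∀ g, η₃ g ∈ V ↔ g ∈ N :=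
    fun N _ _ => exists_openNormal_eta_mem_iff N
  have hs : Surjective σc := fun n => ⟨c ^ n.toAdd, by
    rw [map_zpow, hσcc, ← ofAdd_zsmul, smul_eq_mul, mul_one]; rfl⟩
  have hZ : ∀ A : Subgroup (Multiplicative ℤ), A.FiniteIndex →
      ∀ k : Multiplicative ℤ, ι k ∈ closure (ι '' (A : Set (Multiplicative ℤ))) → k ∈ A :=
    fun A hA k hk => by haveI := hA; exact mem_of_toCompletion_mem_closure A k hk
  haveI hsc3 : SecondCountableTopology P3 := secondCountableTopology_profiniteCompletion_freeGroup (Fin 3)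
  haveI hsc2 : SecondCountableTopology P2 := secondCountableTopology_profiniteCompletion_freeGroup (Fin 2)
  haveI := Literature.NumberTheory.LocalFields.secondCountableTopology_galQp p
  haveI hscΓ : SecondCountableTopology Γ := TemperedFibreProduct.secondCountableTopology Γ
  have hTΓ : IsTempered Γ := isTempered e ι Γ hΓ
  have hSlimΓ : IsSlimGroup Γ := ⟨centralizer_eq_bot_of_isOpen₃ e êa êb îa îb σc σa σb hσca hσcb
    hσaa hσab hσba hσbb he hêa hêb hîa hîb hιinj Γ hΓ⟩
  let toHatΓ : Γ →ₜ* P3 :=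
    ⟨(MonoidHom.fst P3 (Multiplicative ℤ)).comp Γ.subtype, continuous_fst.comp continuous_subtype_val⟩
  have hPC : IsProfiniteCompletion toHatΓ :=
    TemperedFibreProduct.isProfiniteCompletion_fst e ι Γ hΓ η₃ hd3 hηN σc hs he hZ toHatΓ fun _ => rfl
  have hinjΓ : Injective toHatΓ := TemperedFibreProduct.fst_injective e ι Γ hΓ hιinj
  have hsndΓ : Surjective ((MonoidHom.snd P3 (Multiplicative ℤ)).comp Γ.subtype) :=
    snd_surjective_of e ι Γ hΓ (exists_apply_eq_iota e ι η₃ σc hs he)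
  -- the graph of `F₃` is dense: `Γ` is topologically finitely generated
  have hgrmem : ∀ g : FreeGroup (Fin 3), (η₃.prod σc) g ∈ Γ := fun g => (hΓ _).mpr (he g)
  have htfgΓ : IsTopologicallyFinitelyGenerated Γ := by
    refine ⟨⟨_, TemperedFibreProduct.topologicalClosure_closure_graph_eq_top e ι Γ hΓ η₃ hd3 σc hs he
      hZ ((η₃.prod σc).codRestrict Γ hgrmem) (fun _ => rfl)
      (Finset.univ.image (FreeGroup.of : Fin 3 → FreeGroup (Fin 3))) ?_⟩⟩
    rw [Finset.coe_image, Finset.coe_univ, Set.image_univ]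
    exact FreeGroup.closure_range_of _
  -- the cusp: `I = îa(Ẑ) × 0 ≤ Γ`, `D = I × G_{ℚ_p}`
  have hγt : ∀ t, ((îa t, (1 : Multiplicative ℤ)) : P3 × Multiplicative ℤ) ∈ Γ := fun t =>
    (hΓ _).mpr (by change e (îa t) = ι 1; rw [heîa, map_one])
  let I : Subgroup Γ := ((îa.toMonoidHom.range).prod (⊥ : Subgroup (Multiplicative ℤ))).comap Γ.subtype
  have hImem : ∀ γ : Γ, γ ∈ I ↔ (∃ t, îa t = (γ : P3 × Multiplicative ℤ).1) ∧
      (γ : P3 × Multiplicative ℤ).2 = 1 := fun γ => by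
    rw [Subgroup.mem_comap, Subgroup.mem_prod, MonoidHom.mem_range, Subgroup.mem_bot]; rfl
  have hIclosed : IsClosed (I : Set Γ) := by
    have hset : (I : Set Γ) = Subtype.val ⁻¹' (Set.range îa ×ˢ {1}) := by
      ext γ; rw [SetLike.mem_coe, hImem]; rfl
    rw [hset]
    exact ((isCompact_range îa.continuous).isClosed.prod (isClosed_singleton)).preimage
      continuous_subtype_val
  let D : Subgroup (Γ × GQp p) := I.prod ⊤
  have hDmem : ∀ x : Γ × GQp p, x ∈ D ↔ x.1 ∈ I := fun x => by simp [D, Subgroup.mem_prod]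
  have hDclosed : IsClosed (D : Set (Γ × GQp p)) := by
    have : (D : Set (Γ × GQp p)) = Prod.fst ⁻¹' (I : Set Γ) := by ext x; exact hDmem x
    exact this ▸ hIclosed.preimage continuous_fst
  let sndG : Γ × GQp p →ₜ* GQp p := ContinuousMonoidHom.snd _ _
  have hsndD : sndG '' (D : Set (Γ × GQp p)) = Set.univ :=
    Set.eq_univ_of_forall fun g => ⟨(1, g), (hDmem _).2 I.one_mem, rfl⟩
  have hinertia : Nonempty (↥(D ⊓ sndG.toMonoidHom.ker) ≃ₜ* ZHat) := by
    refine ⟨{ toFun := fun x => êa ((x.1.1 : P3 × Multiplicative ℤ).1)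
              invFun := fun t => ⟨(⟨(îa t, 1), hγt t⟩, 1),
                (hDmem _).2 ((hImem _).2 ⟨⟨t, rfl⟩, rfl⟩), (MonoidHom.mem_ker).2 rfl⟩
              left_inv := fun x => ?_
              right_inv := fun t => hêaîa t
              map_mul' := fun x y => by
                change êa (((x : Γ × GQp p) * y).1 : P3 × Multiplicative ℤ).1 =
                  êa ((x : Γ × GQp p).1 : P3 × Multiplicative ℤ).1 *
                    êa ((y : Γ × GQp p).1 : P3 × Multiplicative ℤ).1
                rw [← map_mul]; rfl
              continuous_toFun := êa.continuous.comp ((continuous_fst.comp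
                continuous_subtype_val).comp (continuous_fst.comp continuous_subtype_val))
              continuous_invFun := by
                refine Continuous.subtype_mk (Continuous.prodMk ?_ continuous_const) _
                exact (Continuous.prodMk îa.continuous continuous_const).subtype_mk _ }⟩
    obtain ⟨⟨γ, g⟩, hx⟩ := x
    have hg : g = 1 := (MonoidHom.mem_ker).1 (Subgroup.mem_inf.1 hx).2
    obtain ⟨⟨u, hu⟩, h2⟩ := (hImem _).1 ((hDmem _).1 (Subgroup.mem_inf.1 hx).1)
    apply Subtype.ext
    change ((⟨(îa (êa (γ : P3 × Multiplicative ℤ).1), 1), _⟩ : Γ), (1 : GQp p)) = (γ, g)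
    refine Prod.ext (Subtype.ext (Prod.ext ?_ h2.symm)) hg.symm
    change îa (êa (γ : P3 × Multiplicative ℤ).1) = (γ : P3 × Multiplicative ℤ).1
    rw [← hu, hêaîa]
  let X : TemperedCurve p :=
    { K := ⊥, finiteDimensional_K := inferInstance, PiTemp := Γ × GQp p, aug := sndG
      range_aug := by
        rw [IntermediateField.fixingSubgroup_bot]; exact MonoidHom.range_eq_top.mpr Prod.snd_surjective
      PiHat := P3 × GQp p
      toHat := toHatΓ.prodMap (ContinuousMonoidHom.id (GQp p))
      isProfiniteCompletion_toHat := hPC.prodMap_id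
      toHat_injective := fun x y h => by
        have h1 := congrArg Prod.fst h; have h2 := congrArg Prod.snd h
        exact Prod.ext (hinjΓ h1) h2
      augHat := ContinuousMonoidHom.snd _ _
      augHat_comp := fun _ => rfl
      Pt := Unit, IsCusp := fun _ => True, decomp := fun _ => D, isClosed_decomp := fun _ => hDclosed
      isOpen_aug_decomp := fun _ => by
        change IsOpen (sndG '' (D : Set (Γ × GQp p))); rw [hsndD]; exact isOpen_univ
      inertia_eq_bot := fun _ h => (h trivial).elim
      inertia_equiv_zHat := fun _ _ => hinertia }
  let Y : TemperedCurve p :=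
    { K := ⊥, finiteDimensional_K := inferInstance, PiTemp := P2 × GQp p, aug := ContinuousMonoidHom.snd _ _
      range_aug := by
        rw [IntermediateField.fixingSubgroup_bot]; exact MonoidHom.range_eq_top.mpr Prod.snd_surjective
      PiHat := P2 × GQp p, toHat := ContinuousMonoidHom.id _
      isProfiniteCompletion_toHat := isProfiniteCompletion_id _
      toHat_injective := Function.injective_id
      augHat := ContinuousMonoidHom.snd _ _, augHat_comp := fun _ => rfl
      Pt := PEmpty, IsCusp := fun x => x.elim, decomp := fun x => x.elim
      isClosed_decomp := fun x => x.elim, isOpen_aug_decomp := fun x => x.elim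
      inertia_eq_bot := fun x => x.elim, inertia_equiv_zHat := fun x => x.elim }
  let fHat : P3 × GQp p →ₜ* P2 × GQp p := πh.prodMap (ContinuousMonoidHom.id (GQp p))
  have hinertia_eq : (X.inertia ()).map X.toHat.toMonoidHom =
      (îa.toMonoidHom.range).prod (⊥ : Subgroup (GQp p)) := by
    ext y
    constructor
    · rintro ⟨x, hx, rfl⟩
      obtain ⟨⟨t, ht⟩, -⟩ := (hImem _).1 ((hDmem _).1 (Subgroup.mem_inf.1 hx).1)
      have hg : x.2 = 1 := (MonoidHom.mem_ker).1 (Subgroup.mem_inf.1 hx).2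
      exact Subgroup.mem_prod.mpr ⟨⟨t, ht⟩, by rw [Subgroup.mem_bot]; exact hg⟩
    · intro hy
      obtain ⟨⟨t, ht⟩, hy2⟩ := Subgroup.mem_prod.mp hy
      rw [Subgroup.mem_bot] at hy2
      refine ⟨(⟨(îa t, 1), hγt t⟩, 1), Subgroup.mem_inf.2 ⟨(hDmem _).2 ((hImem _).2 ⟨⟨t, rfl⟩, rfl⟩),
        (MonoidHom.mem_ker).2 rfl⟩, ?_⟩
      exact Prod.ext ht hy2.symm
  let E : DeCuspidalization X Y :=
    { f := fHat.comp (toHatΓ.prodMap (ContinuousMonoidHom.id (GQp p))), fHat := fHat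
      toHat_comp := fun _ => rfl, aug_comp := fun _ => rfl
      fHat_surjective := fun z => ⟨(sh z.1, z.2), Prod.ext (apply_sh_eq π s hπs πh sh hπh hsh z.1) rfl⟩
      x := (), isCusp := trivial
      rational := by
        change sndG '' (D : Set (Γ × GQp p)) = Set.range sndG
        rw [hsndD]; exact (Set.range_eq_univ.mpr Prod.snd_surjective).symm
      ker_fHat := by
        rw [hinertia_eq]; exact ker_prodMap_id_eq π s hπs hπa hkerπ πh sh îa hπh hsh hîa }
  -- `Δ^tp_X = Γ × 1`, `Δ^tp_Y = F̂₂ × 1`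
  have hΔX : ∀ x : Γ × GQp p, x ∈ X.DeltaTemp ↔ x.2 = 1 := fun x => MonoidHom.mem_ker
  have hΔY : ∀ y : P2 × GQp p, y ∈ Y.DeltaTemp ↔ y.2 = 1 := fun y => MonoidHom.mem_ker
  have hΔXeq : X.DeltaTemp = (⊤ : Subgroup Γ).prod (⊥ : Subgroup (GQp p)) := by
    ext x; rw [hΔX, Subgroup.mem_prod, Subgroup.mem_bot]; simp
  have eΔ : ∀ (Q : Type) [Group Q] [TopologicalSpace Q] (H : Subgroup (Q × GQp p)),
      (∀ x, x ∈ H ↔ x.2 = 1) → Nonempty (Q ≃ₜ* H) := fun Q _ _ H hH =>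
    ⟨{ toFun := fun z => ⟨(z, 1), (hH _).2 rfl⟩
       invFun := fun y => y.1.1
       left_inv := fun z => rfl
       right_inv := fun y => Subtype.ext (Prod.ext rfl ((hH _).1 y.2).symm)
       map_mul' := fun z w => Subtype.ext (Prod.ext rfl (by simp))
       continuous_toFun := (continuous_id.prodMk continuous_const).subtype_mk _
       continuous_invFun := continuous_fst.comp continuous_subtype_val }⟩
  obtain ⟨eX⟩ := eΔ Γ X.DeltaTemp hΔX
  obtain ⟨eY⟩ := eΔ P2 Y.DeltaTemp hΔY
  haveI : CompactSpace Y.PiTemp := inferInstanceAs (CompactSpace (P2 × GQp p))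
  haveI : TotallyDisconnectedSpace Y.PiTemp := inferInstanceAs (TotallyDisconnectedSpace (P2 × GQp p))
  haveI : SecondCountableTopology Y.PiTemp := inferInstanceAs (SecondCountableTopology (P2 × GQp p))
  haveI : CompactSpace Y.DeltaTemp := compactSpace_deltaTemp Y
  -- the four intrinsic residues
  have htfg3 : IsTopologicallyFinitelyGenerated X.DeltaTemp :=
    htfgΓ.of_denseRange ({ toMonoidHom := eX.toMulEquiv.toMonoidHom, continuous_toFun := eX.continuous })
      eX.surjective.denseRange
  have htfgY : IsTopologicallyFinitelyGenerated Y.DeltaTemp :=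
    ((SemiGraphOfAnabelioids.IsProSigmaCompletion.isProSigmaCompletion_toCompletion
      (FreeGroup (Fin 2))).isTopologicallyFinitelyGenerated_of_fg).of_denseRange
      ({ toMonoidHom := eY.toMulEquiv.toMonoidHom, continuous_toFun := eY.continuous })
      eY.surjective.denseRange
  have hCF : ∀ N : OpenNormalSubgroup Y.DeltaTemp, ∃ H' : CharOpenSubgroup Y.DeltaTemp,
      (cofreeCore H'.toSubgroup).subgroupOf Y.DeltaTemp ≤ N.toSubgroup :=
    fun N => cofreeCore_cofinal_of_compactSpace htfgY N
  have hmin : ∀ H' : CharOpenSubgroup Y.DeltaTemp, ∃ M, IsMinimalCofreeIn H'.toSubgroup M :=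
    fun H' => H'.exists_isMinimalCofreeIn_of_compactSpace
  have hslimG : IsSlimGroup (GQp p) :=
    IsSubpadicFor.isSlimGroup_absoluteGaloisGroup (AbsTopIII.IsSubpadicFor.padic p)
  have hslim2 : IsSlimGroup P2 :=
    Literature.GroupTheory.isSlimGroup_profiniteCompletion_freeGroup (n := 2) le_rfl
  obtain ⟨dY⟩ := nonempty_groupLevelData_of_compactSpace Y (isSlimGroup_prod hslim2 hslimG)
    (isSlimGroup_of_continuousMulEquiv eY hslim2)
  have hTX : IsTempered (Γ × GQp p) := hTΓ.prod_of_profinite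
  have hkerX : (X.augK X.galoisIdentification).toMonoidHom.ker = X.DeltaTemp :=
    X.ker_augK X.galoisIdentification
  have dX : X.GroupLevelData :=
    { galEquiv := X.galoisIdentification
      isTempered := hTX
      isTempered_ker := by rw [hkerX]; exact hTX.subgroup_of_isClosed _ X.isClosed_deltaTemp
      isSlimGroup := isSlimGroup_prod hSlimΓ hslimG
      isSlimGroup_ker := by rw [hkerX]; exact isSlimGroup_of_continuousMulEquiv eX hSlimΓ
      secondCountableTopology := inferInstanceAs (SecondCountableTopology (Γ × GQp p)) }
  let ψ : Γ × GQp p →* Multiplicative ℤ :=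
    ((MonoidHom.snd P3 (Multiplicative ℤ)).comp Γ.subtype).comp (MonoidHom.fst Γ (GQp p))
  have hψc : Continuous ψ :=
    (continuous_snd.comp continuous_subtype_val).comp continuous_fst
  have hψs : Surjective ψ := fun n => by
    obtain ⟨γ, hγ⟩ := hsndΓ n; exact ⟨(γ, 1), hγ⟩
  have hncpt : ¬ CompactSpace X.PiTemp := not_compactSpace_of_continuous_surjective_int ψ hψc hψs
  -- the top index and its kernel `K_X(Δ^tp_X) ≤ L := Ker ê₂ × 1`
  obtain ⟨Htop, hHtop⟩ := CharOpenSubgroup.exists_eq_self X.DeltaTemp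
  have hcore : cofreeCore Htop.toSubgroup =
      ((((MonoidHom.snd P3 (Multiplicative ℤ)).comp Γ.subtype).ker).prod (⊥ : Subgroup (GQp p))) := by
    rw [hHtop, hΔXeq]; exact TemperedFibreProduct.cofreeCore_top_prod_bot e ι Γ hΓ hsndΓ
  let L : Subgroup (P2 × GQp p) := (ê₂.toMonoidHom.ker).prod ⊥
  have hLmem : ∀ y : P2 × GQp p, y ∈ L ↔ ê₂ y.1 = 1 ∧ y.2 = 1 := fun y => by
    rw [Subgroup.mem_prod, MonoidHom.mem_ker, Subgroup.mem_bot]; rfl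
  haveI : L.Normal := Subgroup.prod_normal _ _
  have hLclosed : IsClosed (L : Set (P2 × GQp p)) := by
    have : (L : Set (P2 × GQp p)) = ((fun y : P2 × GQp p => ê₂ y.1) ⁻¹' {1}) ∩ (Prod.snd ⁻¹' {1}) := by
      ext y; rw [SetLike.mem_coe, hLmem]; rfl
    rw [this]
    exact (isClosed_singleton.preimage (ê₂.continuous.comp continuous_fst)).inter
      (isClosed_singleton.preimage continuous_snd)
  have hKL : coFreeKernel (E.fHat.comp X.toHat) Htop.toSubgroup ≤ L := by
    refine Subgroup.topologicalClosure_minimal _ (Subgroup.normalClosure_le_normal ?_) hLclosed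
    rintro _ ⟨x, hx, rfl⟩
    rw [hcore] at hx
    obtain ⟨hx1, hx2⟩ := Subgroup.mem_prod.mp hx
    rw [Subgroup.mem_bot] at hx2
    have hx1' : ((x.1 : Γ) : P3 × Multiplicative ℤ).2 = 1 := hx1
    rw [SetLike.mem_coe, hLmem]
    refine ⟨?_, hx2⟩
    change ê₂ (πh ((x.1 : Γ) : P3 × Multiplicative ℤ).1) = 1
    rw [hê₂πh, (hΓ _).mp x.1.2, hx1', map_one]
  -- conj. 1 fails
  have hnleft : ¬ (∀ H : CharOpenSubgroup X.DeltaTemp, ∃ H' : CharOpenSubgroup Y.DeltaTemp,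
      coFreeKernel ((ContinuousMonoidHom.id Y.PiHat).comp Y.toHat) H'.toSubgroup ≤
        coFreeKernel (E.fHat.comp X.toHat) H.toSubgroup) := by
    intro hleft
    obtain ⟨H', hH'⟩ := hleft Htop
    have hH'L : H'.toSubgroup ≤ L := fun h hh =>
      hKL (hH' (apply_mem_coFreeKernel _ H'.toSubgroup (by rw [H'.cofreeCore_eq_of_compactSpace]; exact hh)))
    let θ : Y.DeltaTemp →* Zh :=
      ê₂.toMonoidHom.comp ((MonoidHom.fst P2 (GQp p)).comp Y.DeltaTemp.subtype)
    have hle : H'.toSubgroup.subgroupOf Y.DeltaTemp ≤ θ.ker := fun δ hδ => by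
      rw [MonoidHom.mem_ker]
      exact ((hLmem _).1 (hH'L (Subgroup.mem_subgroupOf.mp hδ))).1
    haveI := H'.finiteIndex
    haveI : θ.ker.FiniteIndex := Subgroup.finiteIndex_of_le hle
    have hcard : Nat.card θ.range ≠ 0 := by
      rw [← Subgroup.index_ker]; exact Subgroup.FiniteIndex.index_ne_zero
    haveI : Finite θ.range := Nat.finite_of_card_ne_zero hcard
    have hmemθ : ∀ k : ℤ, ι (Multiplicative.ofAdd k) ∈ θ.range := fun k =>
      ⟨⟨(η₂ (FreeGroup.of 1 ^ k), 1), (hΔY _).2 rfl⟩, by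
        change ê₂ (η₂ (FreeGroup.of 1 ^ k)) = ι (Multiplicative.ofAdd k)
        rw [hê₂, map_zpow, hσ₂1, ← ofAdd_zsmul, smul_eq_mul, mul_one]⟩
    have hinj : Injective (fun k : ℤ => (⟨ι (Multiplicative.ofAdd k), hmemθ k⟩ : θ.range)) :=
      fun k l hkl => by
        have := hιinj (congrArg Subtype.val hkl)
        exact Multiplicative.ofAdd.injective this
    haveI : Infinite θ.range := Infinite.of_injective _ hinj
    exact not_finite θ.range
  -- node (iii) fails
  have hnot : ¬ Prop410iiiAt E := by
    intro h
    haveI := compactSpace_quotient_piKer_of_prop410iiiAt E h Htop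
    have hle : CoFreeCompletion.piKer (E.fHat.comp X.toHat) X.DeltaTemp Htop ≤ ψ.ker := by
      intro x hx
      have hx' : (E.fHat.comp X.toHat) x ∈ coFreeKernel (E.fHat.comp X.toHat) Htop.toSubgroup :=
        (QuotientGroup.eq_one_iff _).mp ((MonoidHom.mem_ker).mp hx)
      have h1 := ((hLmem _).1 (hKL hx')).1
      change ê₂ (πh ((x.1 : Γ) : P3 × Multiplicative ℤ).1) = 1 at h1
      rw [hê₂πh, (hΓ _).mp x.1.2] at h1
      rw [MonoidHom.mem_ker]
      exact hιinj (by rw [map_one]; exact h1)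
    let ψq := QuotientGroup.lift _ ψ hle
    have hψqc : Continuous ψq :=
      QuotientGroup.isOpenQuotientMap_mk.isQuotientMap.continuous_iff.mpr hψc
    have hψqs : Surjective ψq := fun n => by
      obtain ⟨x, hx⟩ := hψs n; exact ⟨QuotientGroup.mk x, hx⟩
    exact not_compactSpace_of_continuous_surjective_int ψq hψqc hψqs inferInstance
  exact ⟨X, Y, E, hCF, hmin, htfg3, ⟨dX⟩, ⟨dY⟩, hncpt, hnleft, hnot, fun h => hnot h.prop410iiiAt⟩

end Literature.AnabelianGeometry.AbsoluteAnabelian.AbsTopI.Prop410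

end
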